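import Literature.NumberTheory.EllipticCurves.OggFormulaWildTypesKodairaProofs
import Literature.NumberTheory.EllipticCurves.OggWildThreeQuadraticProofs
import Literature.NumberTheory.EllipticCurves.OggWildThreeEisensteinDataProofs
import Literature.NumberTheory.EllipticCurves.VariableChangeApproxProofs
import Literature.NumberTheory.EllipticCurves.SwanConductorVariableChangeProofs
import Literature.NumberTheory.EllipticCurves.HasseWeilAbelianConductorSwanIndependenceProofs
import Literature.NumberTheory.EllipticCurves.TateModuleContinuityProofs
import HarnessLib

/-!
# Ogg's formula at `p = 3`: the wild Kodaira types `II, IV, IV*, II*`, and the discharge of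
# `swanConductorAt_rationalTate_eq_wildConductorExponent_of_ringChar_eq_three` (Silverman *ATAEC* IV.11.1)

`Proofs` file (theorems only, no definitions, no named facts), landed by the seat of bsd.S15
(`Literature.NumberTheory.EllipticCurves.conductorNorm_eq_artinConductorNat_of_isElliptic`).  It
assembles **Ogg's formula for the wild part of the conductor at the places `v ∣ 3`**,

  `Sw_𝔓(V_ℓ E) = δ_v`  (`v` additive of residue characteristic `3`, `v ∤ ℓ`, `𝔓 ∣ v`),

i.e. discharges the named fact
`WeierstrassCurve.swanConductorAt_rationalTate_eq_wildConductorExponent_of_ringChar_eq_three W ℓ`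
(`HasseWeilAbelianConductorOggSaito`, the `p = 3` half hW3 of item hW23) for every elliptic curve
over a number field and every prime `ℓ`:

* `WeierstrassCurve.swanConductorAt_rationalTate_two_eq_wildConductorExponent_of_wild` — the four
  wild Kodaira types at `ℓ = 2`: Tate's normal form over `K_v`
  (`exists_variableChange_b_of_kodairaSymbolAt_wild`, `OggFormulaWildTypesKodairaProofs`, tenured
  seat) made `K`-rational (`exists_variableChange_valuation_of_adicCompletion`), an Eisenstein
  rescaling of the `2`-division cubic (`OggWild.exists_eisenstein_data_linear / _quadratic`), the
  ramification of the splitting field of an Eisenstein cubic in residue characteristic `3`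
  (`swanConductorAt_rationalTate_two_eq_of_linear / _quadratic` ← `…_of_eisenstein` ←
  `CubicEisensteinRamification*Proofs` + `swanConductorAt_rationalTate_eq_finsum_ite`), invariance
  of `Sw_𝔓` under the change of equation (`swanConductorAt_rationalTate_variableChange`), and
  `δ_v = ord_v(Δ_min) - (m_v + 1)` (`wildConductorExponent_eq_of_kodairaSymbolAt_wild`);
* `WeierstrassCurve.swanConductorAt_rationalTate_eq_wildConductorExponent_of_ringChar_eq_three_holds`
  — **the discharge**, from the tame types (`OggFormulaTypeIstarProofs`, `OggFormulaTypeIIIProofs`,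
  reduction `…_of_wildTypes`, tenured seat), the wild types at `ℓ = 2`, and `ℓ`-independence of
  the wild conductor at `v ∤ 2` (`…_of_ringChar_eq_three_of_two`,
  `HasseWeilAbelianConductorSwanIndependenceProofs`);
* `WeierstrassCurve.swanConductorAt_rationalTate_eq_wildConductorExponent_of_ringChar_eq_of_two`,
  `Literature.NumberTheory.EllipticCurves.conductorNorm_eq_artinConductorNat_of_isElliptic_of_two` —
  item hW23 and the conductor identity over `ℚ` now follow from the single remaining leaf,
  Ogg–Saito at the additive places of residue characteristic `2`
  (`…_of_ringChar_eq_two`, Saito 1988, not proved in *ATAEC*).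

No definitions, no named facts.  All axioms `propext`, `Classical.choice`, `Quot.sound`.

## References

* J. H. Silverman, *Advanced Topics in the Arithmetic of Elliptic Curves*, GTM 151 (1994),
  Thm. IV.11.1 (Ogg's formula) and its proof for `p = 3` (PDF pp. 366–371); IV.9.4 (Tate's
  algorithm). [SilvermanATAEC1994]
* T. Saito, *Conductor, discriminant, and the Noether formula of arithmetic surfaces*, Duke Math.
  J. 57 (1988), Thm. 1 (the case `p = 2`, cited only). [Saito1988]
* J.-P. Serre, *Local Fields*, GTM 67 (1979), Ch. IV and Ch. VI §2. [SerreLocalFields1979]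
-/

noncomputable section

open scoped Classical NumberField
open Field IsDedekindDomain WithZero

universe u

namespace WeierstrassCurve

open Literature.NumberTheory.EllipticCurves Literature.NumberTheory.GaloisRepresentations
  IsDedekindDomain.HeightOneSpectrum

variable {K : Type u} [Field K] [NumberField K] (W : WeierstrassCurve K)

/-- **Ogg's formula at `p = 3` for the wild Kodaira types, `ℓ = 2`.**  For an elliptic curve
`E/K` over a number field, a finite place `v` of residue characteristic `3` at which `E` has
Kodaira type `II`, `IV`, `IV*` or `II*`, and a prime `𝔓 ∣ v` of `\bar ℤ_K`:

  `Sw_𝔓(V₂ E) = δ_v`.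

Proof (Silverman *ATAEC*, proof of Thm. IV.11.1 for `p = 3`, PDF pp. 368–371, reorganised):
Tate's normal form at `v` (`exists_variableChange_b_of_kodairaSymbolAt_wild`: a `K_v`-model with
`b₂ = π^{k₂}β₂, b₄ = π^{k₄}β₄, b₆ = π^{k₆}·unit, Δ = π^{ord Δ_min}·unit`) is made `K`-rational
(`exists_variableChange_valuation_of_adicCompletion`); on this model `E'` the cubic with roots
`λeᵢ` (types `II, IV*`) or `λeᵢ²` (types `IV, II*`) is integral and Eisenstein at `v` for a
suitable `λ` (`OggWild.exists_eisenstein_data_linear / _quadratic`), so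
`Sw_𝔓(V₂ E') = ord_v(disc) - 2` by the ramification of the splitting field of an Eisenstein cubic
in residue characteristic `3` (`swanConductorAt_rationalTate_two_eq_of_linear / _quadratic`, resting
on `CubicEisensteinRamification*Proofs` and `swanConductorAt_rationalTate_eq_finsum_ite`);
`Sw_𝔓(V₂ E') = Sw_𝔓(V₂ E)` (`swanConductorAt_rationalTate_variableChange`); and
`ord_v(disc) - 2 = ord_v(Δ_min) - (m_v + 1) = δ_v`
(`wildConductorExponent_eq_of_kodairaSymbolAt_wild`, `m_v = 1, 3, 7, 9`).
[cite: SilvermanATAEC1994, Thm. IV.11.1 and its proof for p = 3 (PDF pp. 366–371)] -/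
theorem swanConductorAt_rationalTate_two_eq_wildConductorExponent_of_wild [W.IsElliptic]
    (h : Continuous fun x : absoluteGaloisGroup K × RationalTateModule (geomPoints W) 2 ↦
      rationalTateRepresentation (absoluteGaloisGroup K) (geomPoints W) 2 x.1 x.2)
    (v : HeightOneSpectrum (𝓞 K)) (h3 : ringChar (𝓞 K ⧸ v.asIdeal) = 3)
    (hT : W.kodairaSymbolAt v = .II ∨ W.kodairaSymbolAt v = .IV ∨ W.kodairaSymbolAt v = .IVstar ∨
      W.kodairaSymbolAt v = .IIstar)
    {𝔓 : Ideal (absIntegers (𝓞 K) K)} (h𝔓 : 𝔓 ∈ v.primesAbove) :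
    (rationalTateGaloisRepOf (geomPoints W) 2 h).swanConductorAt (𝓞 K) 𝔓 =
      (W.wildConductorExponent v : ℝ) := by
  haveI : Fact (Nat.Prime 2) := ⟨Nat.prime_two⟩
  haveI : PerfectField (IsLocalRing.ResidueField (v.adicCompletionIntegers K)) := PerfectField.ofFinite
  have h2 : ringChar (𝓞 K ⧸ v.asIdeal) ≠ 2 := by rw [h3]; decide
  have hℓ2 : ((2 : ℕ) : 𝓞 K) ∉ v.asIdeal := v.natCast_notMem_of_ringChar_ne Nat.prime_two h2
  have h2' : (2 : 𝓞 K) ∉ v.asIdeal := by simpa using hℓ2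
  obtain ⟨π, hπ⟩ := v.valuation_exists_uniformizer K
  -- the four types: `(k₂, k₄, k₆)`, `c`, `m`
  rcases hT with hK | hK | hK | hK
  · -- type `II`: `(1,1,1)`, linear with `c = 0`, `m = 1`
    obtain ⟨C, β₂, β₄, β₆, δ, hβ₆, hδ, hb₂, hb₄, hb₆, hΔ⟩ :=
      W.exists_variableChange_b_of_kodairaSymbolAt_wild v h2 (Or.inl ⟨hK, rfl, rfl, rfl⟩) hπ
    obtain ⟨C', hb₂', hb₄', hb₆', hΔ'⟩ :=
      W.exists_variableChange_valuation_of_adicCompletion v C hπ hβ₆ hδ hb₂ hb₄ hb₆ hΔ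
    obtain ⟨lam, c₂, c₁, c₀, n, hlam, hc₂, hc₁, hc₀, hv₂, hv₁, hv₀, hv₀', hn, hne⟩ :=
      OggWild.exists_eisenstein_data_linear (C' • W) v h2' (Or.inl ⟨rfl, rfl, rfl, rfl⟩)
        hb₂' hb₄' hb₆' hΔ'
    have hY := (C' • W).continuous_rationalGaloisRepTate_holds 2
    rw [← W.swanConductorAt_rationalTate_variableChange C' 2 h hY hℓ2 h𝔓,
      (C' • W).swanConductorAt_rationalTate_two_eq_of_linear hY h3 h𝔓 lam hlam hc₂ hc₁ hc₀ hv₂ hv₁ hv₀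
        hv₀' hn,
      W.wildConductorExponent_eq_of_kodairaSymbolAt_wild v (Or.inl ⟨hK, rfl⟩)]
    congr 1; omega
  · -- type `IV`: `(1,2,2)`, quadratic with `c = 1`, `m = 3`
    obtain ⟨C, β₂, β₄, β₆, δ, hβ₆, hδ, hb₂, hb₄, hb₆, hΔ⟩ :=
      W.exists_variableChange_b_of_kodairaSymbolAt_wild v h2 (Or.inr (Or.inl ⟨hK, rfl, rfl, rfl⟩)) hπ
    obtain ⟨C', hb₂', hb₄', hb₆', hΔ'⟩ :=
      W.exists_variableChange_valuation_of_adicCompletion v C hπ hβ₆ hδ hb₂ hb₄ hb₆ hΔ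
    obtain ⟨lam, c₂, c₁, c₀, n, hlam, hc₂, hc₁, hc₀, hv₂, hv₁, hv₀, hv₀', hn, hne⟩ :=
      OggWild.exists_eisenstein_data_quadratic (C' • W) v h2' (Or.inl ⟨rfl, rfl, rfl, rfl⟩)
        hb₂' hb₄' hb₆' hΔ'
    have hY := (C' • W).continuous_rationalGaloisRepTate_holds 2
    rw [← W.swanConductorAt_rationalTate_variableChange C' 2 h hY hℓ2 h𝔓,
      (C' • W).swanConductorAt_rationalTate_two_eq_of_quadratic hY h3 h𝔓 lam hlam hc₂ hc₁ hc₀ hv₂ hv₁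
        hv₀ hv₀' hn,
      W.wildConductorExponent_eq_of_kodairaSymbolAt_wild v (Or.inr (Or.inl ⟨hK, rfl⟩))]
    congr 1; omega
  · -- type `IV*`: `(2,3,4)`, linear with `c = 1`, `m = 7`
    obtain ⟨C, β₂, β₄, β₆, δ, hβ₆, hδ, hb₂, hb₄, hb₆, hΔ⟩ :=
      W.exists_variableChange_b_of_kodairaSymbolAt_wild v h2
        (Or.inr (Or.inr (Or.inl ⟨hK, rfl, rfl, rfl⟩))) hπ
    obtain ⟨C', hb₂', hb₄', hb₆', hΔ'⟩ :=
      W.exists_variableChange_valuation_of_adicCompletion v C hπ hβ₆ hδ hb₂ hb₄ hb₆ hΔ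
    obtain ⟨lam, c₂, c₁, c₀, n, hlam, hc₂, hc₁, hc₀, hv₂, hv₁, hv₀, hv₀', hn, hne⟩ :=
      OggWild.exists_eisenstein_data_linear (C' • W) v h2' (Or.inr ⟨rfl, rfl, rfl, rfl⟩)
        hb₂' hb₄' hb₆' hΔ'
    have hY := (C' • W).continuous_rationalGaloisRepTate_holds 2
    rw [← W.swanConductorAt_rationalTate_variableChange C' 2 h hY hℓ2 h𝔓,
      (C' • W).swanConductorAt_rationalTate_two_eq_of_linear hY h3 h𝔓 lam hlam hc₂ hc₁ hc₀ hv₂ hv₁ hv₀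
        hv₀' hn,
      W.wildConductorExponent_eq_of_kodairaSymbolAt_wild v (Or.inr (Or.inr (Or.inl ⟨hK, rfl⟩)))]
    congr 1; omega
  · -- type `II*`: `(2,4,5)`, quadratic with `c = 3`, `m = 9`
    obtain ⟨C, β₂, β₄, β₆, δ, hβ₆, hδ, hb₂, hb₄, hb₆, hΔ⟩ :=
      W.exists_variableChange_b_of_kodairaSymbolAt_wild v h2
        (Or.inr (Or.inr (Or.inr ⟨hK, rfl, rfl, rfl⟩))) hπ
    obtain ⟨C', hb₂', hb₄', hb₆', hΔ'⟩ :=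
      W.exists_variableChange_valuation_of_adicCompletion v C hπ hβ₆ hδ hb₂ hb₄ hb₆ hΔ
    obtain ⟨lam, c₂, c₁, c₀, n, hlam, hc₂, hc₁, hc₀, hv₂, hv₁, hv₀, hv₀', hn, hne⟩ :=
      OggWild.exists_eisenstein_data_quadratic (C' • W) v h2' (Or.inr ⟨rfl, rfl, rfl, rfl⟩)
        hb₂' hb₄' hb₆' hΔ'
    have hY := (C' • W).continuous_rationalGaloisRepTate_holds 2
    rw [← W.swanConductorAt_rationalTate_variableChange C' 2 h hY hℓ2 h𝔓,
      (C' • W).swanConductorAt_rationalTate_two_eq_of_quadratic hY h3 h𝔓 lam hlam hc₂ hc₁ hc₀ hv₂ hv₁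
        hv₀ hv₀' hn,
      W.wildConductorExponent_eq_of_kodairaSymbolAt_wild v (Or.inr (Or.inr (Or.inr ⟨hK, rfl⟩)))]
    congr 1; omega

/-- **Ogg's formula for the wild part of the conductor at the additive places of residue
characteristic `3`** (discharge of the named fact
`swanConductorAt_rationalTate_eq_wildConductorExponent_of_ringChar_eq_three W ℓ`, for every
prime `ℓ`): `Sw_𝔓(V_ℓ E) = δ_v` for `v ∣ 3` additive, `v ∤ ℓ`, `𝔓 ∣ v`.  The types `Iₙ*`, `III`,
`III*` are tame (`OggFormulaTypeIstarProofs`, `OggFormulaTypeIIIProofs`, reduction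
`…_of_wildTypes`), the wild types at `ℓ = 2` are
`swanConductorAt_rationalTate_two_eq_wildConductorExponent_of_wild`, and `ℓ = 2` suffices by the
`ℓ`-independence of the wild conductor at `v ∤ 2`
(`…_of_ringChar_eq_three_of_two`, `HasseWeilAbelianConductorSwanIndependenceProofs`).  Silverman,
*ATAEC*, Thm. IV.11.1 for `p ≥ 3` (*"Ogg's formula … we give a proof for `p ≥ 3`"*).
[cite: SilvermanATAEC1994, Thm. IV.11.1 and its proof for p = 3 (PDF pp. 366–371)] -/
theorem swanConductorAt_rationalTate_eq_wildConductorExponent_of_ringChar_eq_three_holds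
    (ℓ : ℕ) [Fact ℓ.Prime] :
    W.swanConductorAt_rationalTate_eq_wildConductorExponent_of_ringChar_eq_three ℓ := by
  haveI : Fact (Nat.Prime 2) := ⟨Nat.prime_two⟩
  intro hE h v hℓ hv h3 𝔓 h𝔓
  haveI : W.IsElliptic := hE
  have h3two : W.swanConductorAt_rationalTate_eq_wildConductorExponent_of_ringChar_eq_three 2 := by
    refine W.swanConductorAt_rationalTate_eq_wildConductorExponent_of_ringChar_eq_three_of_wildTypes
      2 ?_
    intro _ h' v' _ _ h3' hT 𝔓' h𝔓'
    exact W.swanConductorAt_rationalTate_two_eq_wildConductorExponent_of_wild h' v' h3' hT h𝔓'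
  exact W.swanConductorAt_rationalTate_eq_wildConductorExponent_of_ringChar_eq_three_of_two ℓ h3two h v
    hℓ hv h3 h𝔓

/-- **Ogg's formula at all additive places (`p = 2` and `p = 3`) from Saito's theorem at
`p = 2` alone**: with the `p = 3` half now proved, the named fact
`swanConductorAt_rationalTate_eq_wildConductorExponent_of_ringChar_eq W ℓ` (item hW23 of
`HasseWeilAbelianConductorOggSaito`) follows from its `p = 2` leaf.
[cite: SilvermanATAEC1994, Thm. IV.11.1] [cite: Saito1988, Theorem 1] -/
theorem swanConductorAt_rationalTate_eq_wildConductorExponent_of_ringChar_eq_of_two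
    (ℓ : ℕ) [Fact ℓ.Prime]
    (h2 : W.swanConductorAt_rationalTate_eq_wildConductorExponent_of_ringChar_eq_two ℓ) :
    W.swanConductorAt_rationalTate_eq_wildConductorExponent_of_ringChar_eq ℓ :=
  W.swanConductorAt_rationalTate_eq_wildConductorExponent_of_ringChar_eq_of_two_of_three ℓ h2
    (W.swanConductorAt_rationalTate_eq_wildConductorExponent_of_ringChar_eq_three_holds ℓ)

end WeierstrassCurve

/-- **The conductor identity for elliptic curves over `ℚ` from Saito's `p = 2` theorem alone.**
With Ogg's formula at `p = 3` proved
(`WeierstrassCurve.swanConductorAt_rationalTate_eq_wildConductorExponent_of_ringChar_eq_three_holds`),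
the seat's target `conductorNorm_eq_artinConductorNat_of_isElliptic W ℓ` (`BSDConductor`) reduces
to the single remaining leaf, Ogg–Saito at the additive places of residue characteristic `2`.
[cite: SilvermanATAEC1994, Thm. IV.11.1] [cite: Saito1988, Theorem 1] -/
theorem Literature.NumberTheory.EllipticCurves.conductorNorm_eq_artinConductorNat_of_isElliptic_of_two
    (W : WeierstrassCurve ℚ) (ℓ : ℕ) [Fact ℓ.Prime]
    (h2 : W.swanConductorAt_rationalTate_eq_wildConductorExponent_of_ringChar_eq_two ℓ) :
    Literature.NumberTheory.EllipticCurves.conductorNorm_eq_artinConductorNat_of_isElliptic W ℓ :=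
  haveI : Fact (Nat.Prime 2) := ⟨Nat.prime_two⟩
  Literature.NumberTheory.EllipticCurves.conductorNorm_eq_artinConductorNat_of_isElliptic_of_two_of_three_two
    W ℓ h2 (W.swanConductorAt_rationalTate_eq_wildConductorExponent_of_ringChar_eq_three_holds 2)

end
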